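import Summits.RiemannHypothesis.RiemannHypothesis.Theorems.MotivicDoorFfRealLattice
import Summits.RiemannHypothesis.RiemannHypothesis.Theorems.SoloInformedHodgeIndex

/-!
# The window form IS the Castelnuovo–Severi defect: Hodge-index shape ⟺ `T_M(q,h) ⪰ 0` ⟺ RH(q,h)
(pub-rhdoor, unit `ffcal`, generation 4, file 2 of 2.  HONEST FRAMING: lottery ticket at the motivic door;
RH probability negligible; consolation prizes are real: a new semi-local Weil-positivity theorem, or a located
gap in the Connes–Consani programme, plus the ff-door theorem.  Nothing here is about `ζ`: "RH(q,h)" is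
`|α| = √q` for the complex roots of ONE integer polynomial `h`, always a hypothesis or a conclusion.)

This file turns the CALIBRATION clauses A4/A5 of the cell's `FFCAL.md` (Hodge-index inertia and the
Castelnuovo–Severi identity, there CERTIFIED as exact integer computations on 2195 + 221 windows) into kernel
theorems about the tree's window form `T_M(q,h) = weilWindowForm q h M` (`PfPersistenceFfAngleTwin`).  Its
number-field sibling is `MotivicDoorCastelnuovoSeveri` (seat cc-3: Castelnuovo–Severi for Connes–Consani's
`D(f)` ⟺ Weil positivity at the same test function).

## The dictionary (a DEFINITION; no surface is constructed)

For `h ∈ ℤ[X]` with complex root multiset `frobRoots h` and power sums `s_k`, put `N_k(q,h) := 1 + q^k - Re s_k`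
(`pointCount`; for the characteristic polynomial of Frobenius of a smooth projective curve `C/𝔽_q` of genus
`g`: `N_k = #C(𝔽_{q^k})` for `k ≥ 1` (Lefschetz) and `N_0 = 2 - 2g`).  The FORMAL NÉRON–SEVERI FORM of the
window `M` (`nsGram`) is the real symmetric matrix on the symbols `H, V, Γ_0, …, Γ_M` with
`H·H = V·V = 0`, `H·V = 1`, `Γ_m·H = 1`, `Γ_m·V = q^m`, `Γ_m·Γ_{m'} = q^{min(m,m')} N_{|m-m'|}` — verbatim the
intersection numbers on `C × C` of the rulings `H = pt × C`, `V = C × pt` and the graphs `Γ_m = {(x, F^m x)}` of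
the powers of the `q`-Frobenius `F` (Weil 1948; Hartshorne, GTM 52, Ex. V.1.9–1.10: `Γ_m·H = 1`, `Γ_m·V = deg F^m
= q^m`, `Γ_m² = q^m (2 - 2g)` by adjunction, `Γ_m·Γ_{m+d} = q^m N_d`; `pointCount_zero`: `N_0 = 2 - deg h`).
`inter`, `degH = (·)·H`, `degV = (·)·V` are the pairing and bidegree of a formal divisor `x = aH + bV + Σ c_m Γ_m`.

## Results (all PROVED, 0 sorry; `q ∈ ℕ`, `q > 0` where stated; `h ∈ ℤ[X]` arbitrary unless stated)

* `two_mul_degH_mul_degV_sub_inter` — THE CASTELNUOVO–SEVERI IDENTITY (FFCAL A5; Weil's computation, typed):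
  `2 (x·H)(x·V) - x·x = cᵀ S_M^ℝ c` with `S_M^ℝ = (q^{min} Re s_{|m-m'|}) = realLattice q h M`; the hyperbolic
  coordinates `a, b` drop out.  Hence `castelnuovoSeveri_iff_realLattice_nonneg`.
* `hodgeIndex_iff_castelnuovoSeveri` — (∀ `x`, `x·(H+V) = 0 → x·x ≤ 0`) ⟺ (∀ `x`, `x·x ≤ 2 (x·H)(x·V)`); `⇒` is
  the tree's abstract `inter_self_le_two_mul_of_hodge` (`SoloInformedHodgeIndex`) instantiated BY NAME.
* `castelnuovoSeveri_iff_posSemidef`, `hodgeIndex_iff_posSemidef` (FFCAL A4) — for `q > 0` each is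
  ⟺ `T_M(q,h) ⪰ 0` (through `realLattice_nonneg_iff_posSemidef` of file 1).
* `hodgeIndex_of_ffRH` — RH(q,h) ⇒ every formal Néron–Severi window has Hodge-index shape: for a genuine
  curve this is the Hodge index theorem on `span{H,V,Γ_0..Γ_M} ⊂ NS(C × C) ⊗ ℝ`, here DERIVED from RH for `h`
  (the direction Weil ran backwards).
* `ffRH_iff_forall_hodgeIndex`, `ffRH_iff_hodgeIndex_lastWindow`, `ffRH_iff_castelnuovoSeveri_lastWindow` — for
  an HONEST datum (`deg h = 2g`, coefficient functional equation): RH(q,h) ⟺ all formal Néron–Severi windows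
  have Hodge-index shape ⟺ the single window `M = 2g - 1` has it ⟺ Castelnuovo–Severi holds for every formal
  divisor of that window.  So the window tower of the explicit formula and the Castelnuovo–Severi defect of
  Frobenius graphs are ONE object, and FFCAL's "minimisers / margins behave as the Hodge index predicts" is an
  identity, not a correlation.

Honest grade: folklore (Weil's proof read as linear algebra); new only as the kernel-checked dictionary
binding `weilWindowForm` to the Néron–Severi form BY NAME.  References: A. Weil, *Sur les courbes algébriques
et les variétés qui s'en déduisent* (Hermann 1948); R. Hartshorne, *Algebraic Geometry*, GTM 52, Ex. V.1.9
(Castelnuovo–Severi `D² ≤ 2ab`) and Ex. V.1.10 (Weil's proof) [corpus: book:hartshorne1977-algebraic-geometry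
pp. 430–431]; M. van Frankenhuijsen, *The Riemann Hypothesis for function fields* (CUP 2014) [corpus: held];
E. Hallouin, M. Perret, Trans. AMS 372 (2019) 5409–5451 [corpus: paper:doi-10-1090-tran-7813].
-/

set_option linter.dupNamespace false

noncomputable section

open Polynomial Matrix Finset
open scoped ComplexOrder

open Summit.RiemannHypothesis.RiemannHypothesis.Theorems.PfPersistence.FfAngleTwin
open Summit.RiemannHypothesis.RiemannHypothesis.Theorems.MotivicDoor.FunctionField
open Summit.RiemannHypothesis.RiemannHypothesis.Theorems.MotivicDoor.FfRealLattice

namespace Summit.RiemannHypothesis.RiemannHypothesis.Theorems.MotivicDoor.FfHodgeIndex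

/-! ## The formal Néron–Severi form of a datum `(q, h)` -/

/-- Virtual point counts `N_k(q,h) = 1 + q^k - Re s_k(h)` (`s_k` the power sums of `frobRoots h`, real for
`h ∈ ℤ[X]`, `powerSum_frobRoots_im`).  DICTIONARY: for the characteristic polynomial of Frobenius of a curve
`C/𝔽_q`, `N_k = #C(𝔽_{q^k})` (`k ≥ 1`, Lefschetz) and `N_0 = 2 - deg h = 2 - 2g`. [folklore] -/
def pointCount (q : ℕ) (h : ℤ[X]) (k : ℕ) : ℝ :=
  1 + (q : ℝ) ^ k - (powerSum (frobRoots h) k).re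

/-- Index type of the Néron–Severi basis of the window `M`: `inl 0 = H`, `inl 1 = V`, `inr m = Γ_m`. -/
abbrev NSIndex (M : ℕ) : Type := Fin 2 ⊕ Fin (M + 1)

/-- The FORMAL NÉRON–SEVERI (intersection) MATRIX of the window `M` of the datum `(q,h)` on the symbols
`H, V, Γ_0, …, Γ_M`: `H² = V² = 0`, `H·V = 1`, `Γ_m·H = 1`, `Γ_m·V = q^m`, `Γ_m·Γ_{m'} = q^{min} N_{|m-m'|}`
(Weil 1948; Hartshorne Ex. V.1.10).  A definition from `(q,h)`; no surface is posited. [folklore] -/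
def nsGram (q : ℕ) (h : ℤ[X]) (M : ℕ) : Matrix (NSIndex M) (NSIndex M) ℝ :=
  Matrix.fromBlocks
    (Matrix.of fun i j : Fin 2 => if i = j then (0 : ℝ) else 1)
    (Matrix.of fun (i : Fin 2) (m : Fin (M + 1)) => if i = 0 then (1 : ℝ) else (q : ℝ) ^ (m : ℕ))
    (Matrix.of fun (m : Fin (M + 1)) (i : Fin 2) => if i = 0 then (1 : ℝ) else (q : ℝ) ^ (m : ℕ))
    (Matrix.of fun m m' : Fin (M + 1) => (q : ℝ) ^ min (m : ℕ) m' * pointCount q h (Nat.dist m m'))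

/-- The intersection pairing `x·y` of two formal divisors `x, y = aH + bV + Σ_m c_m Γ_m` (real coefficient
vectors on `NSIndex M`). [folklore] -/
def inter (q : ℕ) (h : ℤ[X]) (M : ℕ) (x y : NSIndex M → ℝ) : ℝ := x ⬝ᵥ (nsGram q h M *ᵥ y)

/-- The `H`-degree `x·H` of a formal divisor. [folklore] -/
def degH (q : ℕ) (h : ℤ[X]) (M : ℕ) (x : NSIndex M → ℝ) : ℝ := (nsGram q h M *ᵥ x) (Sum.inl 0)

/-- The `V`-degree `x·V` of a formal divisor. [folklore] -/
def degV (q : ℕ) (h : ℤ[X]) (M : ℕ) (x : NSIndex M → ℝ) : ℝ := (nsGram q h M *ᵥ x) (Sum.inl 1)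

variable (q : ℕ) (h : ℤ[X]) (M : ℕ)

/-- Dictionary check: `N_0 = 2 - deg h` (`= 2 - 2g`, so `Γ_m·Γ_m = q^m (2 - 2g)`). [folklore] -/
theorem pointCount_zero : pointCount q h 0 = 2 - (h.natDegree : ℝ) := by
  rw [pointCount, pow_zero, powerSum_zero, card_frobRoots_eq_natDegree, Complex.natCast_re]; ring

/-! ## Coordinates -/

/-- `x·H = b + Σ_m c_m`. [folklore] -/
theorem degH_eq (x : NSIndex M → ℝ) :
    degH q h M x = x (Sum.inl 1) + ∑ m : Fin (M + 1), x (Sum.inr m) := by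
  simp [degH, nsGram, mulVec, dotProduct, Fintype.sum_sum_type, Fin.sum_univ_two, fromBlocks]

/-- `x·V = a + Σ_m q^m c_m`. [folklore] -/
theorem degV_eq (x : NSIndex M → ℝ) :
    degV q h M x = x (Sum.inl 0) + ∑ m : Fin (M + 1), (q : ℝ) ^ (m : ℕ) * x (Sum.inr m) := by
  simp [degV, nsGram, mulVec, dotProduct, Fintype.sum_sum_type, Fin.sum_univ_two, fromBlocks]

/-- `(Γ_m)`-coordinate of `nsGram x`: `a + q^m b + Σ_{m'} q^{min} N_{|m-m'|} c_{m'}`. [folklore] -/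
theorem nsGram_mulVec_inr (x : NSIndex M → ℝ) (m : Fin (M + 1)) :
    (nsGram q h M *ᵥ x) (Sum.inr m) = x (Sum.inl 0) + (q : ℝ) ^ (m : ℕ) * x (Sum.inl 1)
      + ∑ m' : Fin (M + 1), (q : ℝ) ^ min (m : ℕ) m' * pointCount q h (Nat.dist m m') * x (Sum.inr m') := by
  simp [nsGram, mulVec, dotProduct, Fintype.sum_sum_type, Fin.sum_univ_two, fromBlocks]

/-- `x·x = 2ab + 2a Σ c_m + 2b Σ q^m c_m + Σ_{m,m'} c_m c_{m'} q^{min} N_{|m-m'|}`. [folklore] -/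
theorem inter_self_eq (x : NSIndex M → ℝ) :
    inter q h M x x = 2 * x (Sum.inl 0) * x (Sum.inl 1)
      + 2 * x (Sum.inl 0) * (∑ m : Fin (M + 1), x (Sum.inr m))
      + 2 * x (Sum.inl 1) * (∑ m : Fin (M + 1), (q : ℝ) ^ (m : ℕ) * x (Sum.inr m))
      + ∑ m : Fin (M + 1), ∑ m' : Fin (M + 1),
          x (Sum.inr m) * x (Sum.inr m') * ((q : ℝ) ^ min (m : ℕ) m' * pointCount q h (Nat.dist m m')) := by
  have h0 := degH_eq q h M x
  have h1 := degV_eq q h M x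
  simp only [degH] at h0
  simp only [degV] at h1
  simp only [inter, dotProduct, Fintype.sum_sum_type, Fin.sum_univ_two, h0, h1, nsGram_mulVec_inr]
  have hsum : ∑ m : Fin (M + 1), x (Sum.inr m) * (x (Sum.inl 0) + (q : ℝ) ^ (m : ℕ) * x (Sum.inl 1)
      + ∑ m' : Fin (M + 1), (q : ℝ) ^ min (m : ℕ) m' * pointCount q h (Nat.dist m m') * x (Sum.inr m'))
      = x (Sum.inl 0) * (∑ m : Fin (M + 1), x (Sum.inr m))
        + x (Sum.inl 1) * (∑ m : Fin (M + 1), (q : ℝ) ^ (m : ℕ) * x (Sum.inr m))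
        + ∑ m : Fin (M + 1), ∑ m' : Fin (M + 1),
          x (Sum.inr m) * x (Sum.inr m') * ((q : ℝ) ^ min (m : ℕ) m' * pointCount q h (Nat.dist m m')) := by
    rw [Finset.mul_sum, Finset.mul_sum, ← Finset.sum_add_distrib, ← Finset.sum_add_distrib]
    refine Finset.sum_congr rfl fun m _ => ?_
    rw [mul_add, mul_add, Finset.mul_sum]
    have : ∑ m' : Fin (M + 1), x (Sum.inr m)
        * ((q : ℝ) ^ min (m : ℕ) m' * pointCount q h (Nat.dist m m') * x (Sum.inr m'))
        = ∑ m' : Fin (M + 1),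
          x (Sum.inr m) * x (Sum.inr m') * ((q : ℝ) ^ min (m : ℕ) m' * pointCount q h (Nat.dist m m')) :=
      Finset.sum_congr rfl fun m' _ => by ring
    rw [this]; ring
  rw [hsum]; ring

/-! ## The Castelnuovo–Severi identity (FFCAL A5) -/

/-- `q^{min} N_{|m-m'|} + q^{min} Re s_{|m-m'|} = q^m + q^{m'}`. [folklore] -/
theorem pow_min_mul_pointCount_add (m m' : ℕ) :
    (q : ℝ) ^ min m m' * pointCount q h (Nat.dist m m')
      + (q : ℝ) ^ min m m' * (powerSum (frobRoots h) (Nat.dist m m')).re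
      = (q : ℝ) ^ m + (q : ℝ) ^ m' := by
  unfold pointCount
  rcases le_total m m' with hle | hle
  · rw [min_eq_left hle, Nat.dist_eq_sub_of_le hle]
    have e : (q : ℝ) ^ m * (q : ℝ) ^ (m' - m) = (q : ℝ) ^ m' := by
      rw [← pow_add, Nat.add_sub_cancel' hle]
    linear_combination e
  · rw [min_eq_right hle, Nat.dist_eq_sub_of_le_right hle]
    have e : (q : ℝ) ^ m' * (q : ℝ) ^ (m - m') = (q : ℝ) ^ m := by
      rw [← pow_add, Nat.add_sub_cancel' hle]
    linear_combination e

/-- **THE CASTELNUOVO–SEVERI IDENTITY** (Weil 1948; FFCAL.md A5, there checked numerically to `9e-39`):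
for every formal divisor `x = aH + bV + Σ_m c_m Γ_m` of the window `M`,
`2 (x·H)(x·V) - x·x = Σ_{m,m'} c_m c_{m'} q^{min(m,m')} s_{|m-m'|} = cᵀ S_M c`.
The hyperbolic coordinates `a, b` drop out: the defect lives on `Γ'_m = Γ_m - q^m H - V`. [folklore] -/
theorem two_mul_degH_mul_degV_sub_inter (x : NSIndex M → ℝ) :
    2 * degH q h M x * degV q h M x - inter q h M x x
      = (fun m => x (Sum.inr m)) ⬝ᵥ (realLattice q h M *ᵥ fun m => x (Sum.inr m)) := by
  have key : ∀ m m' : Fin (M + 1),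
      x (Sum.inr m) * ((q : ℝ) ^ (m' : ℕ) * x (Sum.inr m'))
        + (q : ℝ) ^ (m : ℕ) * x (Sum.inr m) * x (Sum.inr m')
        - x (Sum.inr m) * x (Sum.inr m') * ((q : ℝ) ^ min (m : ℕ) m' * pointCount q h (Nat.dist m m'))
      = x (Sum.inr m) * ((q : ℝ) ^ min (m : ℕ) m' * (powerSum (frobRoots h) (Nat.dist m m')).re
          * x (Sum.inr m')) := by
    intro m m'
    linear_combination (-(x (Sum.inr m) * x (Sum.inr m'))) * pow_min_mul_pointCount_add q h m m'
  have e : ∀ a b A B Q : ℝ,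
      2 * (b + A) * (a + B) - (2 * a * b + 2 * a * A + 2 * b * B + Q) = A * B + B * A - Q := by
    intros; ring
  rw [degH_eq, degV_eq, inter_self_eq, e, Finset.sum_mul_sum, Finset.sum_mul_sum]
  simp only [dotProduct, mulVec, realLattice, of_apply, Finset.mul_sum]
  rw [← Finset.sum_add_distrib, ← Finset.sum_sub_distrib]
  refine Finset.sum_congr rfl fun m _ => ?_
  rw [← Finset.sum_add_distrib, ← Finset.sum_sub_distrib]
  exact Finset.sum_congr rfl fun m' _ => key m m'

/-- CASTELNUOVO–SEVERI ⟺ THE REAL LATTICE FORM IS NONNEGATIVE: (∀ formal divisors `x` of the window,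
`x·x ≤ 2 (x·H)(x·V)`) ↔ `∀ c, cᵀ S_M c ≥ 0`. [folklore] -/
theorem castelnuovoSeveri_iff_realLattice_nonneg :
    (∀ x : NSIndex M → ℝ, inter q h M x x ≤ 2 * degH q h M x * degV q h M x)
      ↔ ∀ c : Fin (M + 1) → ℝ, 0 ≤ c ⬝ᵥ (realLattice q h M *ᵥ c) := by
  constructor
  · intro hcs c
    have h1 := two_mul_degH_mul_degV_sub_inter q h M (Sum.elim 0 c)
    have h2 := hcs (Sum.elim 0 c)
    have hc : (fun m => Sum.elim (0 : Fin 2 → ℝ) c (Sum.inr m)) = c := funext fun m => rfl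
    rw [hc] at h1
    linarith
  · intro hc x
    have h1 := two_mul_degH_mul_degV_sub_inter q h M x
    have h2 := hc fun m => x (Sum.inr m)
    linarith

/-! ## Symmetry and the basis vectors `H`, `V` -/

/-- The formal Néron–Severi matrix is symmetric. [folklore] -/
theorem nsGram_isSymm : (nsGram q h M).IsSymm := by
  refine Matrix.IsSymm.ext fun i j => ?_
  rcases i with i | m <;> rcases j with j | m'
  · fin_cases i <;> fin_cases j <;> simp [nsGram]
  · simp [nsGram]
  · simp [nsGram]
  · simp [nsGram, min_comm, Nat.dist_comm]

/-- The intersection pairing is symmetric. [folklore] -/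
theorem inter_comm (x y : NSIndex M → ℝ) : inter q h M x y = inter q h M y x := by
  unfold inter
  rw [dotProduct_mulVec, ← mulVec_transpose, (nsGram_isSymm q h M).eq, dotProduct_comm]

/-- `H·x = x·H`. [folklore] -/
theorem inter_single_H (x : NSIndex M → ℝ) :
    inter q h M (Pi.single (Sum.inl 0) 1) x = degH q h M x :=
  single_one_dotProduct _ _

/-- `V·x = x·V`. [folklore] -/
theorem inter_single_V (x : NSIndex M → ℝ) :
    inter q h M (Pi.single (Sum.inl 1) 1) x = degV q h M x :=
  single_one_dotProduct _ _

/-! ## Hodge-index shape ⟺ Castelnuovo–Severi (FFCAL A4) -/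

/-- HODGE-INDEX SHAPE ⟺ CASTELNUOVO–SEVERI for the formal Néron–Severi form of a window: negativity on the
orthogonal complement of the ample class `H + V` (`(H+V)² = 2 > 0`) is equivalent to `x·x ≤ 2 (x·H)(x·V)`
for every formal divisor.  `⇒` is the tree's abstract `inter_self_le_two_mul_of_hodge` (Mattuck–Tate /
Grothendieck; `SoloInformedHodgeIndex`), instantiated BY NAME; `⇐` is one line. [folklore] -/
theorem hodgeIndex_iff_castelnuovoSeveri :
    (∀ x : NSIndex M → ℝ, degH q h M x + degV q h M x = 0 → inter q h M x x ≤ 0)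
      ↔ ∀ x : NSIndex M → ℝ, inter q h M x x ≤ 2 * degH q h M x * degV q h M x := by
  have hI : ∀ u v : NSIndex M → ℝ, Matrix.toBilin' (nsGram q h M) u v = inter q h M u v :=
    fun u v => Matrix.toBilin'_apply' _ _ _
  constructor
  · intro hodge x
    have key := inter_self_le_two_mul_of_hodge (Matrix.toBilin' (nsGram q h M))
      (fun u v => by rw [hI, hI, inter_comm]) (e₁ := Pi.single (Sum.inl 0) 1)
      (e₂ := Pi.single (Sum.inl 1) 1) (by rw [Matrix.toBilin'_single]; simp [nsGram])
      (by rw [Matrix.toBilin'_single]; simp [nsGram]) (by rw [Matrix.toBilin'_single]; simp [nsGram])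
      (fun D hD => by
        rw [hI, inter_comm, inter, add_dotProduct, single_one_dotProduct, single_one_dotProduct] at hD
        rw [hI]
        exact hodge D hD) x
    rwa [hI, hI, hI, inter_comm q h M x (Pi.single (Sum.inl 0) 1), inter_single_H,
      inter_comm q h M x (Pi.single (Sum.inl 1) 1), inter_single_V] at key
  · intro hcs x hx
    have h1 := hcs x
    have h2 : degV q h M x = -degH q h M x := by linarith
    rw [h2] at h1
    nlinarith [sq_nonneg (degH q h M x)]

/-! ## … ⟺ `T_M ⪰ 0` ⟺ RH(q,h) -/

/-- **CASTELNUOVO–SEVERI ⟺ WINDOW POSITIVITY** (`q > 0`): `x·x ≤ 2 (x·H)(x·V)` for every formal divisor of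
the window `M` iff `T_M(q,h) = weilWindowForm q h M ⪰ 0`. [folklore] -/
theorem castelnuovoSeveri_iff_posSemidef (hq : 0 < q) :
    (∀ x : NSIndex M → ℝ, inter q h M x x ≤ 2 * degH q h M x * degV q h M x)
      ↔ (weilWindowForm (q : ℝ) h M).PosSemidef :=
  (castelnuovoSeveri_iff_realLattice_nonneg q h M).trans (realLattice_nonneg_iff_posSemidef q h M hq)

/-- **HODGE-INDEX SHAPE ⟺ WINDOW POSITIVITY** (`q > 0`; FFCAL A4 as a theorem). [folklore] -/
theorem hodgeIndex_iff_posSemidef (hq : 0 < q) :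
    (∀ x : NSIndex M → ℝ, degH q h M x + degV q h M x = 0 → inter q h M x x ≤ 0)
      ↔ (weilWindowForm (q : ℝ) h M).PosSemidef :=
  (hodgeIndex_iff_castelnuovoSeveri q h M).trans (castelnuovoSeveri_iff_posSemidef q h M hq)

/-- **RH(q,h) ⇒ HODGE INDEX on every formal Néron–Severi window** (via `weilWindowForm_posSemidef`,
ffmirror-2).  For a genuine curve this is the Hodge index theorem on `span{H,V,Γ_0..Γ_M}`; here it is
DERIVED from `|α| = √q`. [folklore] -/
theorem hodgeIndex_of_ffRH (hq : 0 < q) (hRH : ∀ α ∈ frobRoots h, ‖α‖ = Real.sqrt q) (M : ℕ) :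
    ∀ x : NSIndex M → ℝ, degH q h M x + degV q h M x = 0 → inter q h M x x ≤ 0 :=
  (hodgeIndex_iff_posSemidef q h M hq).2 (weilWindowForm_posSemidef (by exact_mod_cast hq) hRH M)

/-- **RH(q,h) ⟺ HODGE INDEX ON ALL WINDOWS** for an honest datum (`deg h = 2g`, coefficient functional
equation) — Weil's 1948 proof and its converse as ONE equivalence about the tree's window tower
(`weilWindowForm_posSemidef_depth_iff_ffRH`, ff-1 / ffmirror-2). [folklore] -/
theorem ffRH_iff_forall_hodgeIndex (hq : 0 < q) {g : ℕ} (hdeg : h.natDegree = 2 * g)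
    (hFE : ∀ i j, i + j = 2 * g → (q : ℤ) ^ g * h.coeff j = (q : ℤ) ^ i * h.coeff i) :
    (∀ α ∈ frobRoots h, ‖α‖ = Real.sqrt q)
      ↔ ∀ M : ℕ, ∀ x : NSIndex M → ℝ, degH q h M x + degV q h M x = 0 → inter q h M x x ≤ 0 := by
  refine ⟨fun hRH M => hodgeIndex_of_ffRH q h hq hRH M, fun hall => ?_⟩
  exact (weilWindowForm_posSemidef_depth_iff_ffRH hq hdeg hFE (M := 2 * g) (by omega)).1
    ((hodgeIndex_iff_posSemidef q h (2 * g) hq).1 (hall (2 * g)))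

/-- **THE LAST WINDOW DECIDES**: for an honest datum of dimension `g ≥ 1`, RH(q,h) iff the single formal
Néron–Severi window `M = 2g - 1` (classes `H, V, Γ_0, …, Γ_{2g-1}`) has Hodge-index shape
(`weilWindowForm_posSemidef_lastWindow_iff_ffRH`). [folklore] -/
theorem ffRH_iff_hodgeIndex_lastWindow (hq : 0 < q) {g : ℕ} (hg : 1 ≤ g) (hdeg : h.natDegree = 2 * g)
    (hFE : ∀ i j, i + j = 2 * g → (q : ℤ) ^ g * h.coeff j = (q : ℤ) ^ i * h.coeff i) :
    (∀ α ∈ frobRoots h, ‖α‖ = Real.sqrt q)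
      ↔ ∀ x : NSIndex (2 * g - 1) → ℝ,
          degH q h (2 * g - 1) x + degV q h (2 * g - 1) x = 0 → inter q h (2 * g - 1) x x ≤ 0 := by
  rw [hodgeIndex_iff_posSemidef q h (2 * g - 1) hq]
  exact (weilWindowForm_posSemidef_lastWindow_iff_ffRH hq hg hdeg hFE).symm

/-- … equivalently iff Castelnuovo–Severi holds for every formal divisor of that one window. [folklore] -/
theorem ffRH_iff_castelnuovoSeveri_lastWindow (hq : 0 < q) {g : ℕ} (hg : 1 ≤ g)
    (hdeg : h.natDegree = 2 * g)
    (hFE : ∀ i j, i + j = 2 * g → (q : ℤ) ^ g * h.coeff j = (q : ℤ) ^ i * h.coeff i) :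
    (∀ α ∈ frobRoots h, ‖α‖ = Real.sqrt q)
      ↔ ∀ x : NSIndex (2 * g - 1) → ℝ,
          inter q h (2 * g - 1) x x ≤ 2 * degH q h (2 * g - 1) x * degV q h (2 * g - 1) x := by
  rw [castelnuovoSeveri_iff_posSemidef q h (2 * g - 1) hq]
  exact (weilWindowForm_posSemidef_lastWindow_iff_ffRH hq hg hdeg hFE).symm

end Summit.RiemannHypothesis.RiemannHypothesis.Theorems.MotivicDoor.FfHodgeIndex

end
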